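import Mathlib
import HarnessLib
import Literature.Analysis.FluidPDE.TypeIAncientMild

/-!
# Route `PoloidalWindowDoor`, crux `PoloidalWindowRigidity` (K2, stmt-NavierStokesRegularity-19708) —
# FAR-PAST SATURATION of an extremal element of the poloidal sub-class (normal form for the residue S2′, part 2)

Cell ns-regularity-ideate, K2 lead ns-poloidal-K2-p1 (support file, `--supports stmt-…-19708 --as helper`; task (H1b) of the
lead's PICKED.md; companion of `…PoloidalWindowRigidityPoloidalExtremal`, p469616).

`…PoloidalExtremal.exists_poloidal_extremal` gives, as soon as some poloidal frozen Type-I ancient mild profile is nontrivial,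
an EXTREMAL one: `W ∈ 𝔓(C⋆)` poloidal and frozen with `‖W(−1,0)‖ = C⋆`, `C⋆` minimal among the constants of nontrivial poloidal
frozen elements.  This file adds the first step of the blow-down / recurrence analysis (route `ExtremalTypeIConstant`'s
`extremal_farPast_saturation`, KNSS 2009 §6) INSIDE the sub-class: such a `W` nearly saturates its Type-I bound arbitrarily far
in the past — for every `ε > 0` and `T < 0` there are `t < T`, `x` with `‖W(t,x)‖ > (C⋆ − ε)/√(−t)`.  Proof: otherwise the
time-shifted field `t ↦ W(t − δ)` (again Oseen-mild, poloidal and frozen — the sub-class is invariant under time shifts) is a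
nontrivial poloidal frozen element with a constant `< C⋆`, contradicting minimality.  The blow-down limits along such
saturating times (again extremal, by the compactness half of p469616) are the natural next file (H1c).

* `poloidal_timeShift`, `frozen_timeShift` — invariance of the sub-class under `t ↦ t − δ`, `δ ≥ 0`;
* `poloidal_extremal_farPast_saturation` — the saturation lemma inside the sub-class.

WHAT THIS IS NOT: not a claim about Navier–Stokes regularity and not the residue — a normal-form lemma (bears_on LADDER-NS N0,
rung N0-LocalTubeDoorPoloidal).
-/

noncomputable section

-- the summit and its single sub-problem share the name (CONVENTIONS §1), as in every Theorems file
set_option linter.dupNamespace false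

namespace Summit.NavierStokesRegularity.NavierStokesRegularity.Theorems.PoloidalWindowDoorPoloidalWindowRigidityPoloidalExtremalFarPast

open MeasureTheory Set Function Filter Topology
open scoped RealInnerProductSpace InnerProductSpace
open Literature.Analysis Literature.Analysis.FluidPDE

/-- Poloidality is invariant under a backward time shift (slices are slices). -/
theorem poloidal_timeShift {u : ℝ → EuclideanSpace ℝ (Fin 3) → EuclideanSpace ℝ (Fin 3)}
    (hpol : ∀ s < 0, ∀ y, ⟪curl (u s) y, EuclideanSpace.single 2 (1 : ℝ)⟫_ℝ = 0) {δ : ℝ} (hδ : 0 ≤ δ) :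
    ∀ s < 0, ∀ y, ⟪curl ((fun t => u (t - δ)) s) y, EuclideanSpace.single 2 (1 : ℝ)⟫_ℝ = 0 :=
  fun s hs y => hpol (s - δ) (by linarith) y

/-- The frozen constraint is invariant under a backward time shift. -/
theorem frozen_timeShift {u : ℝ → EuclideanSpace ℝ (Fin 3) → EuclideanSpace ℝ (Fin 3)}
    (hfro : ∀ s < 0, ∀ y, ⟪fderiv ℝ (u s) y (curl (u s) y), EuclideanSpace.single 2 (1 : ℝ)⟫_ℝ = 0) {δ : ℝ} (hδ : 0 ≤ δ) :
    ∀ s < 0, ∀ y, ⟪fderiv ℝ ((fun t => u (t - δ)) s) y (curl ((fun t => u (t - δ)) s) y), EuclideanSpace.single 2 (1 : ℝ)⟫_ℝ = 0 :=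
  fun s hs y => hfro (s - δ) (by linarith) y

/-- **Far-past saturation of an extremal poloidal profile.**  Let `(C, u)` be extremal in the poloidal frozen sub-class:
`u ∈ 𝔓(C)` (`IsTypeIAncientMild C u`) poloidal along `e₂` with the frozen constraint, `‖u(−1,0)‖ = C > 0`, and `C ≤ C'`
whenever `𝔓(C')` contains a nontrivial poloidal frozen element.  Then for every `ε > 0` and `T < 0` there are `t < T` and `x`
with `(C − ε)/√(−t) < ‖u(t,x)‖`. -/
theorem poloidal_extremal_farPast_saturation {C : ℝ} {u : ℝ → EuclideanSpace ℝ (Fin 3) → EuclideanSpace ℝ (Fin 3)}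
    (hC : 0 < C) (hA : IsTypeIAncientMild C u)
    (hpol : ∀ s < 0, ∀ y, ⟪curl (u s) y, EuclideanSpace.single 2 (1 : ℝ)⟫_ℝ = 0)
    (hfro : ∀ s < 0, ∀ y, ⟪fderiv ℝ (u s) y (curl (u s) y), EuclideanSpace.single 2 (1 : ℝ)⟫_ℝ = 0)
    (hnorm : ‖u (-1) 0‖ = C)
    (hmin : ∀ (C' : ℝ) (u' : ℝ → EuclideanSpace ℝ (Fin 3) → EuclideanSpace ℝ (Fin 3)), IsTypeIAncientMild C' u' →
      (∀ s < 0, ∀ y, ⟪curl (u' s) y, EuclideanSpace.single 2 (1 : ℝ)⟫_ℝ = 0) →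
      (∀ s < 0, ∀ y, ⟪fderiv ℝ (u' s) y (curl (u' s) y), EuclideanSpace.single 2 (1 : ℝ)⟫_ℝ = 0) →
      (∃ t < 0, ∃ x, u' t x ≠ 0) → C ≤ C')
    {ε : ℝ} (hε : 0 < ε) {T : ℝ} (hT : T < 0) :
    ∃ t < T, ∃ x : EuclideanSpace ℝ (Fin 3), (C - ε) / Real.sqrt (-t) < ‖u t x‖ := by
  by_contra hcon
  push Not at hcon
  -- `hcon : ∀ t < T, ∀ x, ‖u t x‖ ≤ (C - ε) / √(-t)`
  -- the slack constant is nonnegative (evaluate at one far-past point)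
  have hCε : 0 ≤ C - ε := by
    have h := hcon (T - 1) (by linarith) 0
    have hs : 0 < Real.sqrt (-(T - 1)) := Real.sqrt_pos.2 (by linarith)
    by_contra hneg
    push Not at hneg
    have : (C - ε) / Real.sqrt (-(T - 1)) < 0 := div_neg_of_neg_of_pos hneg hs
    linarith [norm_nonneg (u (T - 1) 0)]
  -- the shift `δ` and the gain `q`
  set δ : ℝ := min (-T / 2) (1 / 2) with hδdef
  have hδpos : 0 < δ := lt_min (by linarith) (by norm_num)
  have hδT : δ < -T := lt_of_le_of_lt (min_le_left _ _) (by linarith)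
  set q : ℝ := Real.sqrt (1 - δ / (-T)) with hqdef
  have hT0 : 0 < -T := by linarith
  have hq_arg : 0 < 1 - δ / (-T) := by
    rw [sub_pos, div_lt_one hT0]; exact hδT
  have hq_arg1 : 1 - δ / (-T) < 1 := by
    have : 0 < δ / (-T) := div_pos hδpos hT0
    linarith
  have hq1 : q < 1 := by
    rw [hqdef, Real.sqrt_lt' one_pos, one_pow]
    exact hq_arg1
  -- the new constant
  set C' : ℝ := max (C - ε) (q * C) with hC'def
  have hC'lt : C' < C := max_lt (by linarith) (by nlinarith)
  -- the shifted field, its class membership and its Type-I bound with constant `C'`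
  have hshift : IsTypeIAncientMild C (fun t => u (t - δ)) := hA.comp_sub_right hδpos.le
  have hdecay : HasTypeITimeDecay C' (fun t => u (t - δ)) := by
    intro t ht x
    have hst : 0 < Real.sqrt (-t) := Real.sqrt_pos.2 (by linarith)
    show ‖u (t - δ) x‖ ≤ C' / Real.sqrt (-t)
    by_cases hfar : t - δ < T
    · -- far past: the assumed slack
      refine (hcon (t - δ) hfar x).trans ?_
      have h1 : (C - ε) / Real.sqrt (-(t - δ)) ≤ (C - ε) / Real.sqrt (-t) :=
        div_le_div_of_nonneg_left hCε hst (Real.sqrt_le_sqrt (by linarith))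
      exact h1.trans (div_le_div_of_nonneg_right (le_max_left _ _) hst.le)
    · -- recent past: the gain of the shift
      push Not at hfar
      have hs0 : t - δ < 0 := by linarith
      refine (hA.norm_le hs0 x).trans ?_
      have hsd : 0 < Real.sqrt (-(t - δ)) := Real.sqrt_pos.2 (by linarith)
      have hmt : -t ≤ -T - δ := by linarith
      have hkey : Real.sqrt (-t) ≤ q * Real.sqrt (-(t - δ)) := by
        rw [hqdef, ← Real.sqrt_mul hq_arg.le]
        refine Real.sqrt_le_sqrt ?_
        rw [show -(t - δ) = δ + -t by ring]
        have e : (1 - δ / -T) * (δ + -t) = δ + -t - δ / -T * δ - δ / -T * -t := by ring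
        rw [e]
        have h2 : δ / -T * -t ≤ δ / -T * (-T - δ) :=
          mul_le_mul_of_nonneg_left hmt (div_pos hδpos hT0).le
        have h3 : δ / -T * (-T - δ) = δ - δ / -T * δ := by
          rw [mul_sub, div_mul_cancel₀ _ hT0.ne']
        nlinarith [h2, h3]
      have hle : C / Real.sqrt (-(t - δ)) ≤ q * C / Real.sqrt (-t) := by
        rw [div_le_div_iff₀ hsd hst]
        calc C * Real.sqrt (-t) ≤ C * (q * Real.sqrt (-(t - δ))) :=
              mul_le_mul_of_nonneg_left hkey hC.le
          _ = q * C * Real.sqrt (-(t - δ)) := by ring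
      exact hle.trans (div_le_div_of_nonneg_right (le_max_right _ _) hst.le)
  have hshift' : IsTypeIAncientMild C' (fun t => u (t - δ)) :=
    ⟨hshift.1, hshift.2.1, hshift.2.2.1, hdecay⟩
  -- nontrivial at `t = -1 + δ`
  have hne : ∃ t < (0 : ℝ), ∃ x, (fun t => u (t - δ)) t x ≠ 0 := by
    have hδ1 : δ < 1 := lt_of_le_of_lt (min_le_right _ _) (by norm_num)
    refine ⟨-1 + δ, by linarith, 0, ?_⟩
    show u (-1 + δ - δ) 0 ≠ 0
    rw [show (-1 : ℝ) + δ - δ = -1 by ring, ← norm_pos_iff, hnorm]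
    exact hC
  -- minimality of `C` inside the sub-class
  have hle : C ≤ C' :=
    hmin C' (fun t => u (t - δ)) hshift' (poloidal_timeShift hpol hδpos.le) (frozen_timeShift hfro hδpos.le) hne
  linarith

end Summit.NavierStokesRegularity.NavierStokesRegularity.Theorems.PoloidalWindowDoorPoloidalWindowRigidityPoloidalExtremalFarPast
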